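import Summits.QuantumFields.YangMills.Theorems.InfiniteVolumeContinuumTemperedMomentBoundLargePiece
import Summits.QuantumFields.YangMills.Theorems.AtomicSynthesisWeightedTensorisation
import Summits.QuantumFields.YangMills.Theorems.InfiniteVolumeContinuumTemperedCurrenciesDefs
import HarnessLib

/-!
# Leaf `HypercubicOSDataFromInfiniteVolume` (stmt-QuantumFields-19868), LINES «TemperedPeak» REV 2 / «OctaveDoubling» REV 2.1 —
# the registered stub E3T `stub_temperedMomentBoundA : WhitneyPkgW → AtomicSqrtDominationR → TemperedMomentBoundA` BY NAME
# (tempered E3, part 3/3: assembly)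

E3's proof (`MirrorCalibration.smearedAtomicBound_proof`, planner ym-idea-11 g15) re-run in the TEMPERED currency:

1. the E1-output E3 consumed (atom ceilings at the uniform level `ε`, from `AtomCeilings` + onset domination) is now
   TMB-A's HYPOTHESIS in ceiling form at the atom's own scale, level `ε (s/a)^M` for a lattice atom of scale `s > a`
   — for a tensor-atom slot of physical size `σ < 1` (`s = a/σ`) the level is `ε (σ^M)⁻¹`;
2. item 28168's clause is used in PRODUCT form (`TemperedMomentBound.sqrtDomClause_prod`, by homogeneity), so a tensor
   atom costs `(C n^θ √ε)ⁿ ∏_l (√(σ_l^M))⁻¹ ≤ (C n^θ √ε)ⁿ (ρ^M)⁻ⁿ ∏_l (ρ/σ_l)^M` (part 1–2);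
3. the atomic synthesis of a large Whitney piece is the WEIGHTED one (`AtomicSynthesisWeighted.atomicSynthesisW` at
   weight exponent `M`: `Σ_i |coef_i| ∏_l (ρ/σ_il)^M ≤ C₁ⁿ M_j`), so a large piece of radius `ρ_j` costs
   `C₁ⁿ (C n^θ √ε)ⁿ · M_j/ρ_j^{Mn}` (`large_piece_bound_tempered`), a near-lattice piece `256ⁿ(2Cₚ)ⁿ M_j` as in E3;
4. the WEIGHTED Whitney package W (`WhitneyPkgW` at `K₀ = M`, landed `stub_weightedWhitneyPkg`) pays
   `Σ_j M_j/ρ_j^{Mn} ≤ α C₂ⁿ (n!)^γ ‖F‖_{Nn}` as well as `Σ_j M_j`; the constant `c n` and its factorial calibration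
   are E3's, character for character.

HONEST LABEL: closes the registered side stub E3T (provable-grade twin of E3) of two DRAFT lines (PWP light) on the
R2a-IV RECORD-rung leaf, as an implication between OPEN Props (W is landed; K2R = item 28168 is an E-wall hypothesis);
the load-bearing D1/D2, N and K2R stay OPEN; no crux, rung, leaf or summit; nothing about Bałaban's RG or Clay is
asserted; the Yang–Mills mass gap is NOT proved. [folklore]
-/

set_option autoImplicit false
noncomputable section
open scoped BigOperators
open MeasureTheory Filter Topology
open Literature.MathematicalPhysics.QuantumFieldTheory Literature.MathematicalPhysics.QuantumLattice
open Literature.MathematicalPhysics.AQFT (IsOffDiagonal)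
open Literature.Probability.LatticeModels (Site)
open Summit.QuantumFields.YangMills.Cruxes.OSLegsFromFemtoAndGap.DlrCollarTransfer (plane exists_abs_plane_le)
open Summit.QuantumFields.YangMills.Theorems.InfiniteVolume (stateMomentStr)
open Summit.QuantumFields.YangMills.Theorems.InfVolRP (centreOffset)
open Summit.QuantumFields.YangMills.Theses.OnsetTautology (AtomicSqrtDominationR)
open Summit.QuantumFields.YangMills.Cruxes.AtomicCalibrationR.MirrorCalibration
open Summit.QuantumFields.YangMills.Cruxes.HypercubicOSDataFromInfiniteVolume.TemperedCurrencies
  (TemperedMomentBoundA WhitneyPkgW)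
open Summit.QuantumFields.YangMills.Theorems.AtomicSynthesisWeighted (atomicSynthesisW)

namespace Summit.QuantumFields.YangMills.Theorems.TemperedMomentBound

/-- **Factorial calibration of the 28168 currency** (E3's `pow_affine_rpow_le_factorial` at `A = 0`, `C = 1`, restated
here to keep this module's import cone free of the route file `TypicalExteriorCeilings`): for `B, κ ≥ 0` and every `n`,
`(B·n^κ)ⁿ ≤ e^{B e^κ}·(n!)^{1+κ}` (`(n^κ)ⁿ = (nⁿ)^κ`, `nⁿ ≤ eⁿ·n!`, `xⁿ ≤ eˣ·n!`). [folklore] -/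
theorem pow_mul_rpow_le_exp_factorial {B κ : ℝ} (hB : 0 ≤ B) (hκ : 0 ≤ κ) (n : ℕ) :
    (B * (n : ℝ) ^ κ) ^ n ≤ Real.exp (B * Real.exp κ) * ((n.factorial : ℝ)) ^ (1 + κ) := by
  rcases Nat.eq_zero_or_pos n with rfl | hn
  · simp only [pow_zero, Nat.factorial_zero, Nat.cast_one, Real.one_rpow, mul_one]
    exact Real.one_le_exp (by positivity)
  have hn0 : (0 : ℝ) ≤ n := by positivity
  have hfac : (0 : ℝ) < n.factorial := by exact_mod_cast n.factorial_pos
  have hpf : ∀ {K : ℝ}, 0 ≤ K → K ^ n ≤ Real.exp K * (n.factorial : ℝ) := fun {K} hK => by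
    have h := Real.pow_div_factorial_le_exp K hK n
    rwa [div_le_iff₀ hfac] at h
  -- `(n^κ)ⁿ = (nⁿ)^κ ≤ (eⁿ·n!)^κ = (e^κ)ⁿ·(n!)^κ`
  have h3 : ((n : ℝ) ^ κ) ^ n = ((n : ℝ) ^ n) ^ κ := by
    rw [← Real.rpow_natCast ((n : ℝ) ^ κ) n, ← Real.rpow_mul hn0, mul_comm, Real.rpow_mul hn0, Real.rpow_natCast]
  have h4 : (n : ℝ) ^ n ≤ Real.exp n * n.factorial := hpf hn0
  have h5 : ((n : ℝ) ^ n) ^ κ ≤ (Real.exp n * n.factorial) ^ κ := Real.rpow_le_rpow (by positivity) h4 hκ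
  have h6 : (Real.exp n * (n.factorial : ℝ)) ^ κ = Real.exp κ ^ n * (n.factorial : ℝ) ^ κ := by
    rw [Real.mul_rpow (Real.exp_pos _).le hfac.le, ← Real.exp_mul, mul_comm (n : ℝ) κ, Real.exp_mul,
      Real.rpow_natCast]
  -- `(B e^κ)ⁿ ≤ e^{B e^κ}·n!`
  have h7 : (B * Real.exp κ) ^ n ≤ Real.exp (B * Real.exp κ) * n.factorial := hpf (by positivity)
  have h8 : ((n.factorial : ℝ)) ^ (1 + κ) = (n.factorial : ℝ) * (n.factorial : ℝ) ^ κ := by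
    rw [Real.rpow_add hfac, Real.rpow_one]
  calc (B * (n : ℝ) ^ κ) ^ n = B ^ n * ((n : ℝ) ^ n) ^ κ := by rw [mul_pow, h3]
    _ ≤ B ^ n * (Real.exp κ ^ n * (n.factorial : ℝ) ^ κ) := by
        rw [← h6]; exact mul_le_mul_of_nonneg_left h5 (pow_nonneg hB n)
    _ = (B * Real.exp κ) ^ n * (n.factorial : ℝ) ^ κ := by rw [mul_pow]; ring
    _ ≤ (Real.exp (B * Real.exp κ) * n.factorial) * (n.factorial : ℝ) ^ κ :=
        mul_le_mul_of_nonneg_right h7 (Real.rpow_nonneg hfac.le _)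
    _ = Real.exp (B * Real.exp κ) * ((n.factorial : ℝ)) ^ (1 + κ) := by rw [h8]; ring

/-- **Tempered E3 — `WhitneyPkgW → AtomicSqrtDominationR → TemperedMomentBoundA`.**  Whitney pieces (W) are split
by radius against the lattice spacing: NEAR-LATTICE pieces (`ρ_j < a`) by counting (E3's H1, `≤ 256ⁿ(2Cₚ)ⁿ M_j`),
LARGE pieces (`ρ_j ≥ a`) by WEIGHTED atomic synthesis + the tempered ceilings + 28168 in product form
(`large_piece_bound_tempered`, `≤ C₁ⁿ (C n^θ √ε)ⁿ M_j/ρ_j^{Mn}`); the Whitney series is interchanged with the lattice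
sum at fixed `a` (H1 majorant), and W's two mass clauses close with E3's constant
`c n = α C₂ⁿ (n!)^γ (Xⁿ + C₁ⁿ Dₙ) ≤ 2α(1+E) (C₂(X+C₁))ⁿ (n!)^{γ+1+θ}`. -/
theorem temperedMomentBoundA_of_whitneyW (hW : WhitneyPkgW) (h68 : AtomicSqrtDominationR) :
    TemperedMomentBoundA := by
  intro M G₁ _ _ _ _ hG hSU
  letI : MeasurableSpace G₁ := borel G₁
  haveI : BorelSpace G₁ := ⟨rfl⟩
  intro r b ε hb hε
  classical
  -- support radius of the profile
  obtain ⟨t₀, ht₀⟩ :=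
    (Metric.isBounded_iff_subset_closedBall (0 : EuclideanSpace ℝ (Fin 4))).1 hb.1.isCompact.isBounded
  set t : ℝ := max t₀ 0 with ht_def
  have ht : 0 ≤ t := le_max_right _ _
  have hbt : ∀ u, b u ≠ 0 → ‖u‖ ≤ t := fun u hu => by
    have hu' : u ∈ Metric.closedBall (0 : EuclideanSpace ℝ (Fin 4)) t₀ := ht₀ (subset_tsupport _ hu)
    rw [mem_closedBall_zero_iff] at hu'
    exact hu'.trans (le_max_left _ _)
  -- constants of the three inputs
  obtain ⟨C, θ, β₄, hC, hθ, h68'⟩ := sqrtDomClause_of h68 G₁ hG hSU r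
  obtain ⟨C₁, N₁, hC₁, hAS'⟩ := atomicSynthesisW b hb.1 hb.2.2.1 M
  obtain ⟨N, α, C₂, γ, hα, hC₂, hγ, hW'⟩ := hW (4 * t + 12) N₁ M (by linarith)
  obtain ⟨Cp, hCp⟩ := exists_abs_plane_le (G := G₁) r
  have hCp0 : 0 ≤ Cp := le_trans (abs_nonneg _) (hCp (0, 1) 0 (fun _ => 1))
  -- the per-order constant and its factorial calibration (E3's, with the calibration lemma restated above)
  have hE := fun n : ℕ => pow_mul_rpow_le_exp_factorial (B := C * Real.sqrt ε) (κ := θ) (by positivity) hθ n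
  refine ⟨fun n => α * C₂ ^ n * (n.factorial : ℝ) ^ γ *
      ((256 * (Cp + Cp)) ^ n + C₁ ^ n * (C * (n : ℝ) ^ θ * Real.sqrt ε) ^ n), N,
    2 * α * (1 + Real.exp ((C * Real.sqrt ε) * Real.exp θ)), C₂ * (256 * (Cp + Cp) + C₁), γ + (1 + θ),
    max β₄ 0, fun n => ⟨by positivity, ?_⟩, ?_⟩
  · -- `c n ≤ α' C'ⁿ (n!)^γ'`
    have hfac : (0 : ℝ) < n.factorial := by exact_mod_cast n.factorial_pos
    set E : ℝ := Real.exp ((C * Real.sqrt ε) * Real.exp θ) with hE_def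
    set X : ℝ := 256 * (Cp + Cp) with hX
    have hX0 : 0 ≤ X := by positivity
    have hD_le : (C * (n : ℝ) ^ θ * Real.sqrt ε) ^ n ≤ E * (n.factorial : ℝ) ^ (1 + θ) := by
      have e : (C * Real.sqrt ε * (n : ℝ) ^ θ) = C * (n : ℝ) ^ θ * Real.sqrt ε := by ring
      have := hE n
      rw [e] at this
      exact this
    have hDn0 : 0 ≤ (C * (n : ℝ) ^ θ * Real.sqrt ε) ^ n := by positivity
    have hE0 : 0 ≤ E := (Real.exp_pos _).le
    have h1 : X ^ n ≤ (X + C₁) ^ n := pow_le_pow_left₀ hX0 (by linarith) n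
    have h2 : C₁ ^ n ≤ (X + C₁) ^ n := pow_le_pow_left₀ hC₁ (by linarith) n
    have h3 : 1 ≤ (n.factorial : ℝ) ^ (1 + θ) :=
      Real.one_le_rpow (by exact_mod_cast Nat.one_le_of_lt n.factorial_pos) (by positivity)
    have hXC0 : 0 ≤ (X + C₁) ^ n := by positivity
    have hQ_le : X ^ n + C₁ ^ n * (C * (n : ℝ) ^ θ * Real.sqrt ε) ^ n ≤
        2 * (1 + E) * (X + C₁) ^ n * (n.factorial : ℝ) ^ (1 + θ) := by
      have s1 : X ^ n ≤ (X + C₁) ^ n * (n.factorial : ℝ) ^ (1 + θ) := by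
        calc X ^ n ≤ (X + C₁) ^ n := h1
          _ = (X + C₁) ^ n * 1 := (mul_one _).symm
          _ ≤ (X + C₁) ^ n * (n.factorial : ℝ) ^ (1 + θ) := mul_le_mul_of_nonneg_left h3 hXC0
      have s2 : C₁ ^ n * (C * (n : ℝ) ^ θ * Real.sqrt ε) ^ n ≤ (X + C₁) ^ n * (E * (n.factorial : ℝ) ^ (1 + θ)) :=
        mul_le_mul h2 hD_le hDn0 hXC0
      have s3 : (X + C₁) ^ n * (n.factorial : ℝ) ^ (1 + θ) + (X + C₁) ^ n * (E * (n.factorial : ℝ) ^ (1 + θ)) =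
          (1 + E) * (X + C₁) ^ n * (n.factorial : ℝ) ^ (1 + θ) := by ring
      have s4 : (1 + E) * (X + C₁) ^ n * (n.factorial : ℝ) ^ (1 + θ) ≤
          2 * (1 + E) * (X + C₁) ^ n * (n.factorial : ℝ) ^ (1 + θ) := by
        have : 0 ≤ (1 + E) * (X + C₁) ^ n * (n.factorial : ℝ) ^ (1 + θ) := by positivity
        linarith
      linarith
    calc α * C₂ ^ n * (n.factorial : ℝ) ^ γ * (X ^ n + C₁ ^ n * (C * (n : ℝ) ^ θ * Real.sqrt ε) ^ n)
        ≤ α * C₂ ^ n * (n.factorial : ℝ) ^ γ * (2 * (1 + E) * (X + C₁) ^ n * (n.factorial : ℝ) ^ (1 + θ)) :=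
          mul_le_mul_of_nonneg_left hQ_le (by positivity)
      _ = 2 * α * (1 + E) * (C₂ * (X + C₁)) ^ n * (n.factorial : ℝ) ^ (γ + (1 + θ)) := by
          rw [show (n.factorial : ℝ) ^ (γ + (1 + θ)) = (n.factorial : ℝ) ^ γ * (n.factorial : ℝ) ^ (1 + θ) from
            Real.rpow_add hfac γ (1 + θ), mul_pow]
          ring
  · -- the bound itself
    intro β hβ μ hμ a ha _ha1 hT n q hn hq F hF
    have hβ4 : β₄ ≤ β := le_trans (le_max_left _ _) hβ
    have h68μ : SqrtDomClause r μ C θ := h68' β hβ4 μ hμ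
    haveI : IsProbabilityMeasure μ := by
      obtain ⟨S, -, hlim⟩ := hμ
      exact hlim.1
    have hn1 : 1 ≤ n := by omega
    obtain ⟨κ, Gp, cp, ρ, Mj, hκ, hρ, hsupp, hsepW, hderiv, hM0, hMsum, hMle, hMwsum, hMwle, hHas⟩ :=
      hW' n hn1 F hF
    set X : ℝ := 256 * (Cp + Cp) with hX
    set Dn : ℝ := (C * (n : ℝ) ^ θ * Real.sqrt ε) ^ n with hDn
    have hDn0 : 0 ≤ Dn := by positivity
    set Φ : ℝ := α * C₂ ^ n * (n.factorial : ℝ) ^ γ * schwartzNorm (N * n) F with hΦ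
    -- sup bounds and supports of the pieces
    have hGsup : ∀ j z, |Gp j z| ≤ Mj j := fun j z => by
      have h0 := hderiv j 0 (Nat.zero_le _) z
      rw [norm_iteratedFDeriv_zero, pow_zero, div_one, Real.norm_eq_abs] at h0
      exact h0
    have hGsupp : ∀ j z, Gp j z ≠ 0 → ∀ l, ‖z l - cp j l‖ ≤ ρ j := fun j z hz => hsupp j (subset_tsupport _ hz)
    -- the weighted piece masses
    have hwnn : ∀ j, 0 ≤ Mj j / ρ j ^ (M * n) := fun j => div_nonneg (hM0 j) (pow_nonneg (hρ j).1.le _)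
    -- per-piece real lattice sums and their bound `|A j| ≤ B j := M_j Xⁿ + (M_j/ρ_j^{Mn}) C₁ⁿ Dₙ`
    set A : ℕ → ℝ := fun j => ∑' x : Fin n → Site 4, stateMomentStr G₁ r μ n q x * Gp j (samplePt a q x)
      with hA_def
    set Bd : ℕ → ℝ := fun j => Mj j * X ^ n + Mj j / ρ j ^ (M * n) * (C₁ ^ n * Dn) with hBd
    have hBd0 : ∀ j, 0 ≤ Bd j := fun j => by
      have := hM0 j; have := hwnn j; positivity
    have hAj : ∀ j, |A j| ≤ Bd j := by
      intro j
      rcases lt_or_ge (ρ j) a with hnear | hfar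
      · -- near-lattice piece: counting
        have hb3 := (piece_tsum_bound r μ hCp q hq ha (hρ j).1.le (cp j) (Gp j) (hGsup j) (hGsupp j)).2.2
        have hρj := (hρ j).1
        have hcount : ((2 * ρ j / a + 2) ^ 4) ^ n ≤ (256 : ℝ) ^ n := by
          apply pow_le_pow_left₀ (by positivity)
          have h2 : 2 * ρ j / a ≤ 2 := by
            rw [div_le_iff₀ ha]
            linarith
          calc (2 * ρ j / a + 2) ^ 4 ≤ (4 : ℝ) ^ 4 := pow_le_pow_left₀ (by positivity) (by linarith) 4
            _ = 256 := by norm_num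
        have hMj := hM0 j
        calc |A j| ≤ ((2 * ρ j / a + 2) ^ 4) ^ n * ((Cp + Cp) ^ n * Mj j) := hb3
          _ ≤ 256 ^ n * ((Cp + Cp) ^ n * Mj j) := mul_le_mul_of_nonneg_right hcount (by positivity)
          _ = Mj j * X ^ n := by rw [hX, mul_pow]; ring
          _ ≤ Bd j := le_add_of_nonneg_right (by have := hwnn j; positivity)
      · -- large piece: weighted atomic synthesis + tempered ceilings + 28168 (product form)
        obtain ⟨coef, σ, η, hsum, hsumw, hle, hση, hrepr⟩ :=
          hAS' n hn1 (Gp j) (cp j) (ρ j) (Mj j) (hρ j).1 (hsupp j) (fun m hm z => hderiv j m hm z)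
        have hb5 := large_piece_bound_tempered r C θ μ hC h68μ b t ε a (ρ j) (4 * t + 12) M ht hbt hε ha hT hfar
          (hρ j).2 le_rfl q (cp j) (Gp j) coef σ η (C₁ ^ n * Mj j) hn hq (hsepW j) hsum hsumw hle hση hrepr
        have hMj := hM0 j
        have hpow : ((ρ j ^ M)⁻¹) ^ n = (ρ j ^ (M * n))⁻¹ := by rw [inv_pow, pow_mul]
        calc |A j| ≤ C₁ ^ n * Mj j * ((ρ j ^ M)⁻¹) ^ n * (C * (n : ℝ) ^ θ * Real.sqrt ε) ^ n := hb5
          _ = Mj j / ρ j ^ (M * n) * (C₁ ^ n * Dn) := by rw [hpow, hDn, div_eq_mul_inv]; ring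
          _ ≤ Bd j := le_add_of_nonneg_left (by positivity)
    -- the complex double family `(j, x) ↦ κ_j M_n(x) G_j(z_x)` and its summability (fixed `a`)
    set fC : ℕ → (Fin n → Site 4) → ℂ := fun j x =>
      κ j * (((stateMomentStr G₁ r μ n q x * Gp j (samplePt a q x) : ℝ)) : ℂ) with hfC
    have hmaj : ∀ j x, ‖fC j x‖ ≤ |stateMomentStr G₁ r μ n q x * Gp j (samplePt a q x)| := fun j x => by
      rw [hfC]
      dsimp only
      rw [norm_mul, Complex.norm_real, Real.norm_eq_abs]
      exact mul_le_of_le_one_left (abs_nonneg _) (hκ j)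
    have hK : ∀ j, ∑' x : Fin n → Site 4, |stateMomentStr G₁ r μ n q x * Gp j (samplePt a q x)| ≤
        ((1 / a + 2) ^ 4) ^ n * ((Cp + Cp) ^ n * Mj j) := by
      intro j
      refine (piece_tsum_bound r μ hCp q hq ha (hρ j).1.le (cp j) (Gp j) (hGsup j) (hGsupp j)).2.1.trans ?_
      have hMj := hM0 j
      refine mul_le_mul_of_nonneg_right ?_ (by positivity)
      apply pow_le_pow_left₀ (by positivity)
      apply pow_le_pow_left₀ (have := (hρ j).1; by positivity)
      have : 2 * ρ j / a ≤ 1 / a := div_le_div_of_nonneg_right (by linarith [(hρ j).2]) ha.le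
      linarith
    have hmajsum : Summable (fun jx : ℕ × (Fin n → Site 4) =>
        |stateMomentStr G₁ r μ n q jx.2 * Gp jx.1 (samplePt a q jx.2)|) := by
      refine (summable_prod_of_nonneg (fun jx => abs_nonneg _)).2 ⟨fun j =>
        (piece_tsum_bound r μ hCp q hq ha (hρ j).1.le (cp j) (Gp j) (hGsup j) (hGsupp j)).1, ?_⟩
      refine Summable.of_nonneg_of_le (fun j => tsum_nonneg fun x => abs_nonneg _) hK ?_
      exact (hMsum.mul_left ((Cp + Cp) ^ n)).mul_left (((1 / a + 2) ^ 4) ^ n)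
    have hunc : Summable (Function.uncurry fC) :=
      Summable.of_norm_bounded hmajsum (fun jx => hmaj jx.1 jx.2)
    -- rewrite the functional as the interchanged double sum
    have hpt : ∀ x : Fin n → Site 4,
        ((stateMomentStr G₁ r μ n q x : ℝ) : ℂ) * F (samplePt a q x) = ∑' j, fC j x := by
      intro x
      rw [← (hHas (samplePt a q x)).tsum_eq, ← tsum_mul_left]
      refine tsum_congr fun j => ?_
      rw [hfC]
      push_cast
      ring
    have hrow : ∀ j, ∑' x, fC j x = κ j * ((A j : ℝ) : ℂ) := fun j => by
      rw [hfC, hA_def]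
      dsimp only
      rw [tsum_mul_left, Complex.ofReal_tsum]
    change ‖∑' x : Fin n → Site 4, ((stateMomentStr G₁ r μ n q x : ℝ) : ℂ) * F (samplePt a q x)‖ ≤
      α * C₂ ^ n * (n.factorial : ℝ) ^ γ * (X ^ n + C₁ ^ n * Dn) * schwartzNorm (N * n) F
    rw [tsum_congr hpt, hunc.tsum_comm]
    simp_rw [hrow]
    have hle : ∀ j, ‖κ j * ((A j : ℝ) : ℂ)‖ ≤ Bd j := fun j => by
      rw [norm_mul, Complex.norm_real, Real.norm_eq_abs]
      calc ‖κ j‖ * |A j| ≤ 1 * |A j| := mul_le_mul_of_nonneg_right (hκ j) (abs_nonneg _)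
        _ = |A j| := one_mul _
        _ ≤ Bd j := hAj j
    have hsumB : Summable Bd := (hMsum.mul_right _).add (hMwsum.mul_right _)
    have hΦ1 : ∑' j, Mj j ≤ Φ := hMle
    have hΦ2 : ∑' j, Mj j / ρ j ^ (M * n) ≤ Φ := hMwle
    calc ‖∑' j, κ j * ((A j : ℝ) : ℂ)‖ ≤ ∑' j, Bd j := tsum_of_norm_bounded hsumB.hasSum hle
      _ = (∑' j, Mj j) * X ^ n + (∑' j, Mj j / ρ j ^ (M * n)) * (C₁ ^ n * Dn) := by
          rw [hBd, (hMsum.mul_right _).tsum_add (hMwsum.mul_right _), tsum_mul_right, tsum_mul_right]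
      _ ≤ Φ * X ^ n + Φ * (C₁ ^ n * Dn) :=
          add_le_add (mul_le_mul_of_nonneg_right hΦ1 (by positivity))
            (mul_le_mul_of_nonneg_right hΦ2 (by positivity))
      _ = α * C₂ ^ n * (n.factorial : ℝ) ^ γ * (X ^ n + C₁ ^ n * Dn) * schwartzNorm (N * n) F := by
          rw [hΦ]; ring

end Summit.QuantumFields.YangMills.Theorems.TemperedMomentBound

/-! ## The registered stub E3T, BY NAME -/

namespace Summit.QuantumFields.YangMills.Cruxes.HypercubicOSDataFromInfiniteVolume.TemperedCurrencies

/-- **E3T `stub_temperedMomentBoundA`** — the registered stub of the g19 lines «TemperedPeak» REV 2 / «OctaveDoubling»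
REV 2.1 on stmt-QuantumFields-19868, by name and signature: the weighted off-diagonal Whitney package and item 28168's
size⟹order clause give the tempered all-order smeared moment bound (E3 re-run with the WEIGHTED atomic synthesis and
the tempered ceilings as hypothesis). [folklore] -/
theorem stub_temperedMomentBoundA : WhitneyPkgW → AtomicSqrtDominationR → TemperedMomentBoundA :=
  Summit.QuantumFields.YangMills.Theorems.TemperedMomentBound.temperedMomentBoundA_of_whitneyW

end Summit.QuantumFields.YangMills.Cruxes.HypercubicOSDataFromInfiniteVolume.TemperedCurrencies

end
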